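import Mathlib
import Summits.CriticalPhenomena.PercolationContinuityZ3.Theorems.PercNearOneGluingNoHeavyLowerTailStarLemma
import Summits.CriticalPhenomena.PercolationContinuityZ3.Theorems.PercNearOneGluingNoHeavyLowerTailCoinExpansion

/-!
# Crux `PercNearOneGluing.NoHeavyLowerTail` (stmt-CriticalPhenomena-4575), line `bhk-superadditivity-thinning` —
# the BLOCK Star Lemma: first-hit charging with TRUE budgets (indirect rescue through block-mates), law level,
# under the block-exchange hypothesis

Lead `prover-line-stmt-CriticalPhenomena-4575-c3-0`, 2026-08-16 (crux note 4); lands with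
`--supports stmt-CriticalPhenomena-4575`.

## Content

Setting as in the Star Lemma (`…StarLemma.lean`, p112026): `k` units `0..k-1` with independent entrance coins of
weights `q j ∈ [0,1]` (integrated out), a finitely supported nonnegative law `(s, p)` of an outcome `ω` carrying
the ALIVE set `L ω` and, for every dead unit `j ∉ L ω`, its BLOCK `cl ω j` (the dead units joined to `j` off the
centre; hypotheses: `j ∈ cl ω j`, blocks of dead units are disjoint from `L ω`, and `i ∈ cl ω j → cl ω i = cl ω j`).
Priority to larger indices; hit weights `q j ∏_{j<i<k} (1 - q i)`.  In the graph a dead unit is rescued through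
the centre as soon as SOME coin of its block is open and some alive coin is open, so its true unreliability is
`rT k j = Σ_ω p ω 1{j ∉ L ω} (Πcl + ΠL − Πcl·ΠL)` with `ΠL = ∏_{i<k, i ∈ L ω}(1 - q i)`,
`Πcl = ∏_{i<k, i ∈ cl ω j}(1 - q i)`; the bad mass is `Σ_ω p ω (ΠL − ∏_{i<k}(1 - q i))` as before.

**Block Star Lemma** (`starLemmaBlocks`, registered form; binder form `starLemmaBlocks'`).  Under the
BLOCK-EXCHANGE HYPOTHESIS — for every `m < k`, every coin pattern `Z ⊆ {0..m-1}` and every `h < m`: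
`Σ_ω p ω 1{m ∈ L, h ∉ L, Z ∩ L = ∅, Z ∩ cl h ≠ ∅} ≤ Σ_ω p ω 1{m ∉ L, Z ∩ cl m = ∅, Z ∩ L ≠ ∅, h ∉ cl m}` —
the bad mass is at most the hit-weighted sum of the TRUE unreliabilities: `bad ≤ Σ_{j<k} w_j · rT k j`.
For percolation laws (units = relay points round a star-attached observer, `L` = alive in `G − o`, blocks =
clusters of `G − o`, units ordered by deadness) the hypothesis is Kozma–Nitzan Lemma 3(ii) with the decreasing
cluster event "`C(m)` avoids `Z ∪ {h}`" (`blockExchange`, p116050), so this file is the law-level half of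
lead c3's theorem "first-hit charging with true budgets for star-attached observers" (crux note 4), which settles
lead c1's FH-kn(star) and MAXD(star).  The arbitrary-law analogue WITHOUT the exchange hypothesis is false
(note 3), which is why the hypothesis is carried explicitly.

Proof: induction on `k` peeling the top unit; exact recursions for the bad mass (reused from p112026) and for
`rT`; the step reduces to the bracket inequality `T ≤ 0`, which the coin expansion (`coinExpansion_disjoint`,
p116238) rewrites as a nonnegative combination of instances of the hypothesis.
[cite: KozmaNitzan2024, Lemma 3(ii) p. 6 and §3.2 Thm 4 (deadness order)]
-/

namespace Summit.CriticalPhenomena.PercolationContinuityZ3.Theorems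

open Finset

open scoped BigOperators

variable {Ω : Type*}

/-! ### Coin-pattern expansions -/

/-- The filtered-product form of `ΠL`. -/
theorem sbPi_eq_prod_filter (q : ℕ → ℝ) (X : Finset ℕ) (m : ℕ) : (Finset.prod (Finset.range m) (fun i => if i ∈ X then (1 : ℝ) - q i else 1)) = ∏ a ∈ (Finset.range m).filter (fun a => a ∈ X), ((1 : ℝ) - q a) := by
  rw [Finset.prod_filter]

/-- `ΠL` of a disjoint union factorises. -/
theorem sbPi_union (q : ℕ → ℝ) {X Y : Finset ℕ} (hXY : Disjoint X Y) (m : ℕ) : (Finset.prod (Finset.range m) (fun i => if i ∈ (X ∪ Y) then (1 : ℝ) - q i else 1)) = (Finset.prod (Finset.range m) (fun i => if i ∈ X then (1 : ℝ) - q i else 1)) * (Finset.prod (Finset.range m) (fun i => if i ∈ Y then (1 : ℝ) - q i else 1)) := by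
  rw [← Finset.prod_mul_distrib]
  refine Finset.prod_congr rfl fun i _ => ?_
  by_cases hX : i ∈ X
  · have hY : i ∉ Y := Finset.disjoint_left.1 hXY hX
    simp [hX, hY]
  · by_cases hY : i ∈ Y
    · simp [hX, hY]
    · simp [hX, hY]

/-- Coin expansion of `ΠL`: the probability that the open coin pattern misses `X`. -/
theorem sbPi_eq_sum_powerset (q : ℕ → ℝ) (X : Finset ℕ) (m : ℕ) : (Finset.prod (Finset.range m) (fun i => if i ∈ X then (1 : ℝ) - q i else 1)) = ∑ Z ∈ (Finset.range m).powerset, (if Disjoint Z X then ((Finset.prod Z (fun a => q a)) * Finset.prod (Finset.range m \ Z) (fun a => (1 : ℝ) - q a)) else 0) := by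
  rw [sbPi_eq_prod_filter, ← coinExpansion_disjoint (Finset.range m) X q]

/-- Coin expansion of `ΠX · (1 - ΠY)` for disjoint `X, Y`: the pattern misses `X` and meets `Y`. -/
theorem sbPi_mul_one_sub_eq_sum (q : ℕ → ℝ) {X Y : Finset ℕ} (hXY : Disjoint X Y) (m : ℕ) : (Finset.prod (Finset.range m) (fun i => if i ∈ X then (1 : ℝ) - q i else 1)) * (1 - (Finset.prod (Finset.range m) (fun i => if i ∈ Y then (1 : ℝ) - q i else 1))) = ∑ Z ∈ (Finset.range m).powerset, (if Disjoint Z X ∧ ¬ Disjoint Z Y then ((Finset.prod Z (fun a => q a)) * Finset.prod (Finset.range m \ Z) (fun a => (1 : ℝ) - q a)) else 0) := by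
  rw [mul_sub, mul_one, ← sbPi_union q hXY m, sbPi_eq_sum_powerset q X m,
    sbPi_eq_sum_powerset q (X ∪ Y) m, ← Finset.sum_sub_distrib]
  refine Finset.sum_congr rfl fun Z _ => ?_
  by_cases h1 : Disjoint Z X
  · by_cases h2 : Disjoint Z Y
    · have h3 : Disjoint Z (X ∪ Y) := Finset.disjoint_union_right.2 ⟨h1, h2⟩
      simp [h1, h2, h3]
    · have h3 : ¬ Disjoint Z (X ∪ Y) := fun h => h2 (Finset.disjoint_union_right.1 h).2
      simp [h1, h2, h3]
  · have h3 : ¬ Disjoint Z (X ∪ Y) := fun h => h1 (Finset.disjoint_union_right.1 h).1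
    simp [h1, h3]

/-- Nonnegativity of the coin-pattern weights. -/
theorem sbCZ_nonneg (q : ℕ → ℝ) (hq0 : ∀ j, 0 ≤ q j) (hq1 : ∀ j, q j ≤ 1) (m : ℕ) (Z : Finset ℕ) :
    0 ≤ ((Finset.prod Z (fun a => q a)) * Finset.prod (Finset.range m \ Z) (fun a => (1 : ℝ) - q a)) :=
  mul_nonneg (Finset.prod_nonneg fun a _ => hq0 a) (Finset.prod_nonneg fun a _ => by linarith [hq1 a])

/-! ### Recursions for the true unreliability -/

/-- Pointwise recursion of the integrand of `rT` below the top. -/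
theorem sbRT_integrand_succ (q : ℕ → ℝ) (X Y : Finset ℕ) (hXY : Disjoint Y X) (m : ℕ) : ((Finset.prod (Finset.range (m + 1)) (fun i => if i ∈ Y then (1 : ℝ) - q i else 1)) + (Finset.prod (Finset.range (m + 1)) (fun i => if i ∈ X then (1 : ℝ) - q i else 1)) - (Finset.prod (Finset.range (m + 1)) (fun i => if i ∈ Y then (1 : ℝ) - q i else 1)) * (Finset.prod (Finset.range (m + 1)) (fun i => if i ∈ X then (1 : ℝ) - q i else 1))) = ((Finset.prod (Finset.range m) (fun i => if i ∈ Y then (1 : ℝ) - q i else 1)) + (Finset.prod (Finset.range m) (fun i => if i ∈ X then (1 : ℝ) - q i else 1)) - (Finset.prod (Finset.range m) (fun i => if i ∈ Y then (1 : ℝ) - q i else 1)) * (Finset.prod (Finset.range m) (fun i => if i ∈ X then (1 : ℝ) - q i else 1))) - q m * ((if m ∈ Y then (Finset.prod (Finset.range m) (fun i => if i ∈ Y then (1 : ℝ) - q i else 1)) * (1 - (Finset.prod (Finset.range m) (fun i => if i ∈ X then (1 : ℝ) - q i else 1))) else 0) + (if m ∈ X then (Finset.prod (Finset.range m) (fun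 i => if i ∈ X then (1 : ℝ) - q i else 1)) * (1 - (Finset.prod (Finset.range m) (fun i => if i ∈ Y then (1 : ℝ) - q i else 1))) else 0)) := by
  rw [slPi_succ q Y m, slPi_succ q X m]
  by_cases hY : m ∈ Y
  · have hX : m ∉ X := Finset.disjoint_left.1 hXY hY
    rw [if_pos hY, if_neg hX, if_pos hY, if_neg hX]
    ring
  · by_cases hX : m ∈ X
    · rw [if_neg hY, if_pos hX, if_neg hY, if_pos hX]
      ring
    · rw [if_neg hY, if_neg hX, if_neg hY, if_neg hX]
      ring

/-- Recursion for `rT` below the top: the new coin `m` adds rescue mass when `m` is a block-mate of `j` (term `C`) or when `m` is alive (term `E`). -/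
theorem sbRT_succ_of_lt (s : Finset Ω) (p : Ω → ℝ) (L : Ω → Finset ℕ) (cl : Ω → ℕ → Finset ℕ) (hdisj : ∀ ω ∈ s, ∀ j, j ∉ L ω → Disjoint (cl ω j) (L ω)) (q : ℕ → ℝ) (m j : ℕ) : (Finset.sum s (fun ω => p ω * (if j ∈ L ω then (0 : ℝ) else ((Finset.prod (Finset.range ((m + 1))) (fun i => if i ∈ (cl ω j) then (1 : ℝ) - q i else 1)) + (Finset.prod (Finset.range ((m + 1))) (fun i => if i ∈ (L ω) then (1 : ℝ) - q i else 1)) - (Finset.prod (Finset.range ((m + 1))) (fun i => if i ∈ (cl ω j) then (1 : ℝ) - q i else 1)) * (Finset.prod (Finset.range ((m + 1))) (fun i => if i ∈ (L ω) then (1 : ℝ) - q i else 1)))))) = (Finset.sum s (fun ω => p ω * (if j ∈ L ω then (0 : ℝ) else ((Finset.prod (Finset.range m) (fun i => if i ∈ (cl ω j) then (1 : ℝ) - q i else 1)) + (Finset.prod (Finset.range m) (fun i => if i ∈ (L ω) then (1 : ℝ) - q i else 1)) - (Finset.prod (Finset.range m) (fun i => if i ∈ (cl ω j) then (1 : ℝ)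 - q i else 1)) * (Finset.prod (Finset.range m) (fun i => if i ∈ (L ω) then (1 : ℝ) - q i else 1)))))) - q m * (∑ ω ∈ s, p ω * (if j ∈ L ω then (0 : ℝ) else ((if m ∈ cl ω j then (Finset.prod (Finset.range m) (fun i => if i ∈ (cl ω j) then (1 : ℝ) - q i else 1)) * (1 - (Finset.prod (Finset.range m) (fun i => if i ∈ (L ω) then (1 : ℝ) - q i else 1))) else 0) + (if m ∈ L ω then (Finset.prod (Finset.range m) (fun i => if i ∈ (L ω) then (1 : ℝ) - q i else 1)) * (1 - (Finset.prod (Finset.range m) (fun i => if i ∈ (cl ω j) then (1 : ℝ) - q i else 1))) else 0)))) := by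
  rw [Finset.mul_sum, ← Finset.sum_sub_distrib]
  refine Finset.sum_congr rfl fun ω hω => ?_
  by_cases hj : j ∈ L ω
  · simp [hj]
  · rw [if_neg hj, if_neg hj, if_neg hj, sbRT_integrand_succ q (L ω) (cl ω j) (hdisj ω hω j hj) m]
    ring

/-- The true unreliability of the top unit in the enlarged system. -/
theorem sbRT_succ_self (s : Finset Ω) (p : Ω → ℝ) (L : Ω → Finset ℕ) (cl : Ω → ℕ → Finset ℕ) (hself : ∀ ω ∈ s, ∀ j, j ∈ cl ω j) (q : ℕ → ℝ) (m : ℕ) : (Finset.sum s (fun ω => p ω * (if m ∈ L ω then (0 : ℝ) else ((Finset.prod (Finset.range ((m + 1))) (fun i => if i ∈ (cl ω m) then (1 : ℝ) - q i else 1)) + (Finset.prod (Finset.range ((m + 1))) (fun i => if i ∈ (L ω) then (1 : ℝ) - q i else 1)) - (Finset.prod (Finset.range ((m + 1))) (fun i => if i ∈ (cl ω m) then (1 : ℝ) - q i else 1)) * (Finset.prod (Finset.range ((m + 1))) (fun i => if i ∈ (L ω) then (1 : ℝ) - q i else 1)))))) = ∑ ω ∈ s, p ω * (if m ∈ L ω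 then (0 : ℝ) else ((1 - q m) * (Finset.prod (Finset.range m) (fun i => if i ∈ (cl ω m) then (1 : ℝ) - q i else 1)) + (Finset.prod (Finset.range m) (fun i => if i ∈ (L ω) then (1 : ℝ) - q i else 1)) - (1 - q m) * (Finset.prod (Finset.range m) (fun i => if i ∈ (cl ω m) then (1 : ℝ) - q i else 1)) * (Finset.prod (Finset.range m) (fun i => if i ∈ (L ω) then (1 : ℝ) - q i else 1)))) := by
  refine Finset.sum_congr rfl fun ω hω => ?_
  by_cases hm : m ∈ L ω
  · simp [hm]
  · rw [if_neg hm, if_neg hm, slPi_succ q (cl ω m) m, slPi_succ q (L ω) m, if_pos (hself ω hω m),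
      if_neg hm]
    ring

/-! ### The bracket inequality from the block-exchange hypothesis -/

/-- **The bracket is nonpositive.**  For the top unit `m`: the hit-weighted `E`-terms are dominated by the
top unit's own rescue-corrected budget, granted the block-exchange hypothesis at level `m`. -/
theorem sbBracket_le (s : Finset Ω) (p : Ω → ℝ) (hp : ∀ ω ∈ s, 0 ≤ p ω) (L : Ω → Finset ℕ) (cl : Ω → ℕ → Finset ℕ) (hdisj : ∀ ω ∈ s, ∀ j, j ∉ L ω → Disjoint (cl ω j) (L ω)) (q : ℕ → ℝ) (hq0 : ∀ j, 0 ≤ q j) (hq1 : ∀ j, q j ≤ 1) (m : ℕ) (hBX : ∀ (Z : Finset ℕ), Z ⊆ Finset.range m → ∀ h, h < m → (∑ ω ∈ s, p ω * (if m ∈ L ω ∧ h ∉ L ω ∧ Disjoint Z (L ω) ∧ ¬ Disjoint Z (cl ω h) then (1 : ℝ) else 0)) ≤ ∑ ω ∈ s, p ω * (if m ∉ L ω ∧ Disjoint Z (cl ω m) ∧ ¬ Disjoint Z (L ω) ∧ h ∉ cl ω m then (1 : ℝ) else 0)) :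
    ∑ j ∈ Finset.range m, ((q j) * Finset.prod (Finset.Ico (j + 1) m) (fun i => (1 : ℝ) - q i)) * (∑ ω ∈ s, p ω * (if j ∈ L ω then (0 : ℝ) else (if m ∈ L ω then (Finset.prod (Finset.range m) (fun i => if i ∈ (L ω) then (1 : ℝ) - q i else 1)) * (1 - (Finset.prod (Finset.range m) (fun i => if i ∈ (cl ω j) then (1 : ℝ) - q i else 1))) else 0))) ≤ ∑ ω ∈ s, p ω * (if m ∈ L ω then (0 : ℝ) else (Finset.prod (Finset.range m) (fun i => if i ∈ (cl ω m) then (1 : ℝ) - q i else 1)) * (1 - (Finset.prod (Finset.range m) (fun i => if i ∈ (L ω) then (1 : ℝ) - q i else 1))) * (1 - ∑ j ∈ (Finset.range m).filter (fun j => j ∈ cl ω m), ((q j) * Finset.prod (Finset.Ico (j + 1) m) (fun i => (1 : ℝ) - q i)))) := by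
  -- abbreviations for the two sides of the hypothesis
  set A : Finset ℕ → ℕ → ℝ := fun Z h =>
    ∑ ω ∈ s, p ω * (if m ∈ L ω ∧ h ∉ L ω ∧ Disjoint Z (L ω) ∧ ¬ Disjoint Z (cl ω h) then (1 : ℝ) else 0) with hA
  set B : Finset ℕ → ℕ → ℝ := fun Z h =>
    ∑ ω ∈ s, p ω * (if m ∉ L ω ∧ Disjoint Z (cl ω m) ∧ ¬ Disjoint Z (L ω) ∧ h ∉ cl ω m then (1 : ℝ) else 0) with hB
  have hw0 : ∀ j, 0 ≤ ((q j) * Finset.prod (Finset.Ico (j + 1) m) (fun i => (1 : ℝ) - q i)) := fun j => slW_nonneg q hq0 hq1 m j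
  have hcZ0 : ∀ Z, 0 ≤ ((Finset.prod Z (fun a => q a)) * Finset.prod (Finset.range m \ Z) (fun a => (1 : ℝ) - q a)) := fun Z => sbCZ_nonneg q hq0 hq1 m Z
  -- (1) rewrite the left side as Σ_Z cZ Σ_j w_j A(Z,j)
  have hL : ∑ j ∈ Finset.range m, ((q j) * Finset.prod (Finset.Ico (j + 1) m) (fun i => (1 : ℝ) - q i)) * (∑ ω ∈ s, p ω * (if j ∈ L ω then (0 : ℝ) else (if m ∈ L ω then (Finset.prod (Finset.range m) (fun i => if i ∈ (L ω) then (1 : ℝ) - q i else 1)) * (1 - (Finset.prod (Finset.range m) (fun i => if i ∈ (cl ω j) then (1 : ℝ) - q i else 1))) else 0))) = ∑ Z ∈ (Finset.range m).powerset, ((Finset.prod Z (fun a => q a)) * Finset.prod (Finset.range m \ Z) (fun a => (1 : ℝ) - q a)) * ∑ j ∈ Finset.range m, ((q j) * Finset.prod (Finset.Ico (j + 1) m) (fun i => (1 : ℝ) - q i)) * A Z j := by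
    -- expand each ω-integrand in coin patterns
    have hpt : ∀ j ∈ Finset.range m, ∀ ω ∈ s,
        p ω * (if j ∈ L ω then (0 : ℝ) else (if m ∈ L ω then (Finset.prod (Finset.range m) (fun i => if i ∈ (L ω) then (1 : ℝ) - q i else 1)) * (1 - (Finset.prod (Finset.range m) (fun i => if i ∈ (cl ω j) then (1 : ℝ) - q i else 1))) else 0)) = ∑ Z ∈ (Finset.range m).powerset, ((Finset.prod Z (fun a => q a)) * Finset.prod (Finset.range m \ Z) (fun a => (1 : ℝ) - q a)) * (p ω * (if m ∈ L ω ∧ j ∉ L ω ∧ Disjoint Z (L ω) ∧ ¬ Disjoint Z (cl ω j) then (1 : ℝ) else 0)) := by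
      intro j _ ω hω
      by_cases hj : j ∈ L ω
      · simp [hj]
      · by_cases hm : m ∈ L ω
        · rw [if_neg hj, if_pos hm, sbPi_mul_one_sub_eq_sum q (hdisj ω hω j hj).symm m, Finset.mul_sum]
          refine Finset.sum_congr rfl fun Z _ => ?_
          by_cases hc : Disjoint Z (L ω) ∧ ¬ Disjoint Z (cl ω j)
          · rw [if_pos hc, if_pos ⟨hm, hj, hc⟩]; ring
          · have : ¬ (m ∈ L ω ∧ j ∉ L ω ∧ Disjoint Z (L ω) ∧ ¬ Disjoint Z (cl ω j)) :=
              fun h => hc ⟨h.2.2.1, h.2.2.2⟩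
            rw [if_neg hc, if_neg this]; ring
        · simp [hj, hm]
    calc ∑ j ∈ Finset.range m, ((q j) * Finset.prod (Finset.Ico (j + 1) m) (fun i => (1 : ℝ) - q i)) * (∑ ω ∈ s, p ω * (if j ∈ L ω then (0 : ℝ) else (if m ∈ L ω then (Finset.prod (Finset.range m) (fun i => if i ∈ (L ω) then (1 : ℝ) - q i else 1)) * (1 - (Finset.prod (Finset.range m) (fun i => if i ∈ (cl ω j) then (1 : ℝ) - q i else 1))) else 0))) = ∑ j ∈ Finset.range m, ((q j) * Finset.prod (Finset.Ico (j + 1) m) (fun i => (1 : ℝ) - q i)) *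
            ∑ Z ∈ (Finset.range m).powerset, ((Finset.prod Z (fun a => q a)) * Finset.prod (Finset.range m \ Z) (fun a => (1 : ℝ) - q a)) * A Z j := by
          refine Finset.sum_congr rfl fun j hj => ?_
          congr 1
          rw [Finset.sum_congr rfl (hpt j hj), Finset.sum_comm]
          refine Finset.sum_congr rfl fun Z _ => ?_
          rw [hA, Finset.mul_sum]
      _ = ∑ Z ∈ (Finset.range m).powerset, ((Finset.prod Z (fun a => q a)) * Finset.prod (Finset.range m \ Z) (fun a => (1 : ℝ) - q a)) * ∑ j ∈ Finset.range m, ((q j) * Finset.prod (Finset.Ico (j + 1) m) (fun i => (1 : ℝ) - q i)) * A Z j := by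
          have h1 : ∀ j ∈ Finset.range m, ((q j) * Finset.prod (Finset.Ico (j + 1) m) (fun i => (1 : ℝ) - q i)) * ∑ Z ∈ (Finset.range m).powerset, ((Finset.prod Z (fun a => q a)) * Finset.prod (Finset.range m \ Z) (fun a => (1 : ℝ) - q a)) * A Z j = ∑ Z ∈ (Finset.range m).powerset, ((q j) * Finset.prod (Finset.Ico (j + 1) m) (fun i => (1 : ℝ) - q i)) * (((Finset.prod Z (fun a => q a)) * Finset.prod (Finset.range m \ Z) (fun a => (1 : ℝ) - q a)) * A Z j) :=
            fun j _ => Finset.mul_sum _ _ _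
          rw [Finset.sum_congr rfl h1, Finset.sum_comm]
          refine Finset.sum_congr rfl fun Z _ => ?_
          rw [Finset.mul_sum]
          refine Finset.sum_congr rfl fun j _ => ?_
          ring
  -- (2) lower-bound the right side by Σ_Z cZ Σ_j w_j B(Z,j)
  have hsumw : ∀ ω ∈ s,
      ∑ j ∈ (Finset.range m).filter (fun j => j ∉ cl ω m), ((q j) * Finset.prod (Finset.Ico (j + 1) m) (fun i => (1 : ℝ) - q i)) ≤ 1 - ∑ j ∈ (Finset.range m).filter (fun j => j ∈ cl ω m), ((q j) * Finset.prod (Finset.Ico (j + 1) m) (fun i => (1 : ℝ) - q i)) := by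
    intro ω _
    have htot : ∑ j ∈ (Finset.range m).filter (fun j => j ∈ cl ω m), ((q j) * Finset.prod (Finset.Ico (j + 1) m) (fun i => (1 : ℝ) - q i)) + ∑ j ∈ (Finset.range m).filter (fun j => j ∉ cl ω m), ((q j) * Finset.prod (Finset.Ico (j + 1) m) (fun i => (1 : ℝ) - q i)) = ∑ j ∈ Finset.range m, ((q j) * Finset.prod (Finset.Ico (j + 1) m) (fun i => (1 : ℝ) - q i)) :=
      Finset.sum_filter_add_sum_filter_not _ _ _
    have hle1 : ∑ j ∈ Finset.range m, ((q j) * Finset.prod (Finset.Ico (j + 1) m) (fun i => (1 : ℝ) - q i)) ≤ 1 := by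
      have h := starLemma_sum_filter_slW_le q hq0 hq1 (Finset.range m) m
      have hfilt : (Finset.range m).filter (fun j => j ∈ Finset.range m) = Finset.range m :=
        Finset.filter_true_of_mem fun j hj => hj
      rw [hfilt] at h
      linarith [slPi_nonneg q hq0 hq1 (Finset.range m) m]
    linarith
  have hR : ∑ Z ∈ (Finset.range m).powerset, ((Finset.prod Z (fun a => q a)) * Finset.prod (Finset.range m \ Z) (fun a => (1 : ℝ) - q a)) * ∑ j ∈ Finset.range m, ((q j) * Finset.prod (Finset.Ico (j + 1) m) (fun i => (1 : ℝ) - q i)) * B Z j ≤ ∑ ω ∈ s, p ω * (if m ∈ L ω then (0 : ℝ) else (Finset.prod (Finset.range m) (fun i => if i ∈ (cl ω m) then (1 : ℝ) - q i else 1)) * (1 - (Finset.prod (Finset.range m) (fun i => if i ∈ (L ω) then (1 : ℝ) - q i else 1))) * (1 - ∑ j ∈ (Finset.range m).filter (fun j => j ∈ cl ω m), ((q j) * Finset.prod (Finset.Ico (j + 1) m) (fun i => (1 : ℝ) - q i)))) := by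
    -- pointwise in ω: expand ΠL_cl (1 - ΠL_L) and compare the hit-weight factors
    have hpt : ∀ ω ∈ s,
        ∑ Z ∈ (Finset.range m).powerset, ((Finset.prod Z (fun a => q a)) * Finset.prod (Finset.range m \ Z) (fun a => (1 : ℝ) - q a)) * ∑ j ∈ Finset.range m, ((q j) * Finset.prod (Finset.Ico (j + 1) m) (fun i => (1 : ℝ) - q i)) * (p ω * (if m ∉ L ω ∧ Disjoint Z (cl ω m) ∧ ¬ Disjoint Z (L ω) ∧ j ∉ cl ω m then (1 : ℝ) else 0)) ≤ p ω * (if m ∈ L ω then (0 : ℝ) else (Finset.prod (Finset.range m) (fun i => if i ∈ (cl ω m) then (1 : ℝ) - q i else 1)) * (1 - (Finset.prod (Finset.range m) (fun i => if i ∈ (L ω) then (1 : ℝ) - q i else 1))) * (1 - ∑ j ∈ (Finset.range m).filter (fun j => j ∈ cl ω m), ((q j) * Finset.prod (Finset.Ico (j + 1) m) (fun i => (1 : ℝ) - q i)))) := by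
      intro ω hω
      by_cases hm : m ∈ L ω
      · simp [hm]
      · rw [if_neg hm]
        have hexp := sbPi_mul_one_sub_eq_sum q (hdisj ω hω m hm) m
        -- inner sum over j for fixed Z
        have hinner : ∀ Z ∈ (Finset.range m).powerset,
            ∑ j ∈ Finset.range m, ((q j) * Finset.prod (Finset.Ico (j + 1) m) (fun i => (1 : ℝ) - q i)) * (p ω * (if m ∉ L ω ∧ Disjoint Z (cl ω m) ∧ ¬ Disjoint Z (L ω) ∧ j ∉ cl ω m then (1 : ℝ) else 0)) = (if Disjoint Z (cl ω m) ∧ ¬ Disjoint Z (L ω) then (1 : ℝ) else 0) * (p ω * ∑ j ∈ (Finset.range m).filter (fun j => j ∉ cl ω m), ((q j) * Finset.prod (Finset.Ico (j + 1) m) (fun i => (1 : ℝ) - q i))) := by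
          intro Z _
          rw [Finset.sum_filter, Finset.mul_sum, Finset.mul_sum]
          refine Finset.sum_congr rfl fun j _ => ?_
          by_cases hc : Disjoint Z (cl ω m) ∧ ¬ Disjoint Z (L ω)
          · by_cases hjc : j ∈ cl ω m
            · simp [hjc]
            · rw [if_pos ⟨hm, hc.1, hc.2, hjc⟩, if_pos hc, if_pos hjc]; ring
          · have : ¬ (m ∉ L ω ∧ Disjoint Z (cl ω m) ∧ ¬ Disjoint Z (L ω) ∧ j ∉ cl ω m) :=
              fun h => hc ⟨h.2.1, h.2.2.1⟩
            rw [if_neg this, if_neg hc]; ring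
        rw [Finset.sum_congr rfl fun Z hZ => by rw [hinner Z hZ]]
        have hfac : ∑ Z ∈ (Finset.range m).powerset, ((Finset.prod Z (fun a => q a)) * Finset.prod (Finset.range m \ Z) (fun a => (1 : ℝ) - q a)) * ((if Disjoint Z (cl ω m) ∧ ¬ Disjoint Z (L ω) then (1 : ℝ) else 0) * (p ω * ∑ j ∈ (Finset.range m).filter (fun j => j ∉ cl ω m), ((q j) * Finset.prod (Finset.Ico (j + 1) m) (fun i => (1 : ℝ) - q i)))) = ((Finset.prod (Finset.range m) (fun i => if i ∈ (cl ω m) then (1 : ℝ) - q i else 1)) * (1 - (Finset.prod (Finset.range m) (fun i => if i ∈ (L ω) then (1 : ℝ) - q i else 1)))) * (p ω * ∑ j ∈ (Finset.range m).filter (fun j => j ∉ cl ω m), ((q j) * Finset.prod (Finset.Ico (j + 1) m) (fun i => (1 : ℝ) - q i))) := by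
          rw [hexp, Finset.sum_mul]
          refine Finset.sum_congr rfl fun Z _ => ?_
          split_ifs <;> ring
        rw [hfac]
        have hnn : 0 ≤ (Finset.prod (Finset.range m) (fun i => if i ∈ (cl ω m) then (1 : ℝ) - q i else 1)) * (1 - (Finset.prod (Finset.range m) (fun i => if i ∈ (L ω) then (1 : ℝ) - q i else 1))) :=
          mul_nonneg (slPi_nonneg q hq0 hq1 _ _) (by linarith [slPi_le_one q hq0 hq1 (L ω) m])
        have := hsumw ω hω
        have hpω := hp ω hω
        nlinarith [mul_le_mul_of_nonneg_left this hpω, hnn]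
    calc ∑ Z ∈ (Finset.range m).powerset, ((Finset.prod Z (fun a => q a)) * Finset.prod (Finset.range m \ Z) (fun a => (1 : ℝ) - q a)) * ∑ j ∈ Finset.range m, ((q j) * Finset.prod (Finset.Ico (j + 1) m) (fun i => (1 : ℝ) - q i)) * B Z j = ∑ ω ∈ s, ∑ Z ∈ (Finset.range m).powerset, ((Finset.prod Z (fun a => q a)) * Finset.prod (Finset.range m \ Z) (fun a => (1 : ℝ) - q a)) * ∑ j ∈ Finset.range m, ((q j) * Finset.prod (Finset.Ico (j + 1) m) (fun i => (1 : ℝ) - q i)) * (p ω * (if m ∉ L ω ∧ Disjoint Z (cl ω m) ∧ ¬ Disjoint Z (L ω) ∧ j ∉ cl ω m then (1 : ℝ) else 0)) := by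
          rw [Finset.sum_comm]
          refine Finset.sum_congr rfl fun Z _ => ?_
          rw [← Finset.mul_sum]
          congr 1
          rw [Finset.sum_comm]
          refine Finset.sum_congr rfl fun j _ => ?_
          rw [hB, Finset.mul_sum]
      _ ≤ _ := Finset.sum_le_sum hpt
  -- (3) compare via the hypothesis
  have hmid : ∑ Z ∈ (Finset.range m).powerset, ((Finset.prod Z (fun a => q a)) * Finset.prod (Finset.range m \ Z) (fun a => (1 : ℝ) - q a)) * ∑ j ∈ Finset.range m, ((q j) * Finset.prod (Finset.Ico (j + 1) m) (fun i => (1 : ℝ) - q i)) * A Z j ≤ ∑ Z ∈ (Finset.range m).powerset, ((Finset.prod Z (fun a => q a)) * Finset.prod (Finset.range m \ Z) (fun a => (1 : ℝ) - q a)) * ∑ j ∈ Finset.range m, ((q j) * Finset.prod (Finset.Ico (j + 1) m) (fun i => (1 : ℝ) - q i)) * B Z j := by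
    refine Finset.sum_le_sum fun Z hZ => mul_le_mul_of_nonneg_left ?_ (hcZ0 Z)
    refine Finset.sum_le_sum fun j hj => mul_le_mul_of_nonneg_left ?_ (hw0 j)
    exact hBX Z (Finset.mem_powerset.1 hZ) j (Finset.mem_range.1 hj)
  rw [hL]
  exact hmid.trans hR

/-! ### The block-mate identity and the main induction -/

/-- The `C`-terms (new coin is a dead block-mate) regroup onto the top unit's block: pointwise in `ω`. -/
theorem sbC_regroup (s : Finset Ω) (p : Ω → ℝ) (L : Ω → Finset ℕ) (cl : Ω → ℕ → Finset ℕ) (hself : ∀ ω ∈ s, ∀ j, j ∈ cl ω j) (hdisj : ∀ ω ∈ s, ∀ j, j ∉ L ω → Disjoint (cl ω j) (L ω)) (hblk : ∀ ω ∈ s, ∀ i j, j ∉ L ω → i ∈ cl ω j → cl ω i = cl ω j) (q : ℕ → ℝ) (m : ℕ) :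
    ∑ j ∈ Finset.range m, ((q j) * Finset.prod (Finset.Ico (j + 1) m) (fun i => (1 : ℝ) - q i)) * (∑ ω ∈ s, p ω * (if j ∈ L ω then (0 : ℝ) else (if m ∈ cl ω j then (Finset.prod (Finset.range m) (fun i => if i ∈ (cl ω j) then (1 : ℝ) - q i else 1)) * (1 - (Finset.prod (Finset.range m) (fun i => if i ∈ (L ω) then (1 : ℝ) - q i else 1))) else 0))) = ∑ ω ∈ s, p ω * (if m ∈ L ω then (0 : ℝ) else (Finset.prod (Finset.range m) (fun i => if i ∈ (cl ω m) then (1 : ℝ) - q i else 1)) * (1 - (Finset.prod (Finset.range m) (fun i => if i ∈ (L ω) then (1 : ℝ) - q i else 1))) *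
            ∑ j ∈ (Finset.range m).filter (fun j => j ∈ cl ω m), ((q j) * Finset.prod (Finset.Ico (j + 1) m) (fun i => (1 : ℝ) - q i))) := by
  -- swap the sums and argue pointwise in ω
  have hswap : ∑ j ∈ Finset.range m, ((q j) * Finset.prod (Finset.Ico (j + 1) m) (fun i => (1 : ℝ) - q i)) * (∑ ω ∈ s, p ω * (if j ∈ L ω then (0 : ℝ) else (if m ∈ cl ω j then (Finset.prod (Finset.range m) (fun i => if i ∈ (cl ω j) then (1 : ℝ) - q i else 1)) * (1 - (Finset.prod (Finset.range m) (fun i => if i ∈ (L ω) then (1 : ℝ) - q i else 1))) else 0))) = ∑ ω ∈ s, ∑ j ∈ Finset.range m, ((q j) * Finset.prod (Finset.Ico (j + 1) m) (fun i => (1 : ℝ) - q i)) * (p ω * (if j ∈ L ω then (0 : ℝ) else (if m ∈ cl ω j then (Finset.prod (Finset.range m) (fun i => if i ∈ (cl ω j) then (1 : ℝ) - q i else 1)) * (1 - (Finset.prod (Finset.range m) (fun i => if i ∈ (L ω) then (1 : ℝ) - q i else 1))) else 0))) := by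
    rw [Finset.sum_comm]
    refine Finset.sum_congr rfl fun j _ => ?_
    rw [Finset.mul_sum]
  rw [hswap]
  refine Finset.sum_congr rfl fun ω hω => ?_
  by_cases hm : m ∈ L ω
  · rw [if_pos hm, mul_zero]
    refine Finset.sum_eq_zero fun j _ => ?_
    by_cases hj : j ∈ L ω
    · simp [hj]
    · have hmj : m ∉ cl ω j := fun h => Finset.disjoint_left.1 (hdisj ω hω j hj) h hm
      simp [hj, hmj]
  · rw [if_neg hm, Finset.mul_sum, Finset.mul_sum, Finset.sum_filter]
    refine Finset.sum_congr rfl fun j _ => ?_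
    by_cases hjc : j ∈ cl ω m
    · have hcl : cl ω j = cl ω m := hblk ω hω j m hm hjc
      have hj : j ∉ L ω := fun h => Finset.disjoint_left.1 (hdisj ω hω m hm) hjc h
      have hmj : m ∈ cl ω j := by rw [hcl]; exact hself ω hω m
      rw [if_neg hj, if_pos hmj, if_pos hjc, hcl]
      ring
    · by_cases hj : j ∈ L ω
      · simp [hj, hjc]
      · have hmj : m ∉ cl ω j := by
          intro h
          have := hblk ω hω m j hj h
          exact hjc (this ▸ hself ω hω j)
        simp [hj, hjc, hmj]

/-- **The Block Star Lemma (binder form).** Under the block-exchange hypothesis at every level `m < k`, the bad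
mass is at most the hit-weighted sum of the TRUE unreliabilities. -/
theorem starLemmaBlocks' (s : Finset Ω) (p : Ω → ℝ) (hp : ∀ ω ∈ s, 0 ≤ p ω) (L : Ω → Finset ℕ) (cl : Ω → ℕ → Finset ℕ) (hself : ∀ ω ∈ s, ∀ j, j ∈ cl ω j) (hdisj : ∀ ω ∈ s, ∀ j, j ∉ L ω → Disjoint (cl ω j) (L ω)) (hblk : ∀ ω ∈ s, ∀ i j, j ∉ L ω → i ∈ cl ω j → cl ω i = cl ω j) (q : ℕ → ℝ) (hq0 : ∀ j, 0 ≤ q j) (hq1 : ∀ j, q j ≤ 1) (k : ℕ) (hBX : ∀ m, m < k → ∀ (Z : Finset ℕ), Z ⊆ Finset.range m → ∀ h, h < m → (∑ ω ∈ s, p ω * (if m ∈ L ω ∧ h ∉ L ω ∧ Disjoint Z (L ω) ∧ ¬ Disjoint Z (cl ω h) then (1 : ℝ) else 0)) ≤ ∑ ω ∈ s, p ω * (if m ∉ L ω ∧ Disjoint Z (cl ω m) ∧ ¬ Disjoint Z (L ω) ∧ h ∉ cl ω m then (1 : ℝ) else 0)) : (Finset.sum s (fun ω => p ω * ((Finset.prod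 (Finset.range k) (fun i => if i ∈ (L ω) then (1 : ℝ) - q i else 1)) - Finset.prod (Finset.range k) (fun i => (1 : ℝ) - q i)))) ≤ ∑ j ∈ Finset.range k, ((q j) * Finset.prod (Finset.Ico (j + 1) k) (fun i => (1 : ℝ) - q i)) * (Finset.sum s (fun ω => p ω * (if j ∈ L ω then (0 : ℝ) else ((Finset.prod (Finset.range k) (fun i => if i ∈ (cl ω j) then (1 : ℝ) - q i else 1)) + (Finset.prod (Finset.range k) (fun i => if i ∈ (L ω) then (1 : ℝ) - q i else 1)) - (Finset.prod (Finset.range k) (fun i => if i ∈ (cl ω j) then (1 : ℝ) - q i else 1)) * (Finset.prod (Finset.range k) (fun i => if i ∈ (L ω) then (1 : ℝ) - q i else 1)))))) := by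
  induction k with
  | zero =>
    simp
  | succ k ih =>
    have hBX' : ∀ m, m < k → ∀ (Z : Finset ℕ), Z ⊆ Finset.range m → ∀ h, h < m → (∑ ω ∈ s, p ω * (if m ∈ L ω ∧ h ∉ L ω ∧ Disjoint Z (L ω) ∧ ¬ Disjoint Z (cl ω h) then (1 : ℝ) else 0)) ≤ ∑ ω ∈ s, p ω * (if m ∉ L ω ∧ Disjoint Z (cl ω m) ∧ ¬ Disjoint Z (L ω) ∧ h ∉ cl ω m then (1 : ℝ) else 0) :=
      fun m hm => hBX m (Nat.lt_succ_of_lt hm)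
    have IH := ih hBX'
    have hqk0 := hq0 k
    have hqk1 : 0 ≤ 1 - q k := by linarith [hq1 k]
    -- abbreviations
    set CE : ℕ → ℝ := fun j => ∑ ω ∈ s, p ω * (if j ∈ L ω then (0 : ℝ) else ((if k ∈ cl ω j then (Finset.prod (Finset.range k) (fun i => if i ∈ (cl ω j) then (1 : ℝ) - q i else 1)) * (1 - (Finset.prod (Finset.range k) (fun i => if i ∈ (L ω) then (1 : ℝ) - q i else 1))) else 0) + (if k ∈ L ω then (Finset.prod (Finset.range k) (fun i => if i ∈ (L ω) then (1 : ℝ) - q i else 1)) * (1 - (Finset.prod (Finset.range k) (fun i => if i ∈ (cl ω j) then (1 : ℝ) - q i else 1))) else 0))) with hCE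
    set Cc : ℕ → ℝ := fun j => ∑ ω ∈ s, p ω * (if j ∈ L ω then (0 : ℝ) else (if k ∈ cl ω j then (Finset.prod (Finset.range k) (fun i => if i ∈ (cl ω j) then (1 : ℝ) - q i else 1)) * (1 - (Finset.prod (Finset.range k) (fun i => if i ∈ (L ω) then (1 : ℝ) - q i else 1))) else 0)) with hCc
    set Ee : ℕ → ℝ := fun j => ∑ ω ∈ s, p ω * (if j ∈ L ω then (0 : ℝ) else (if k ∈ L ω then (Finset.prod (Finset.range k) (fun i => if i ∈ (L ω) then (1 : ℝ) - q i else 1)) * (1 - (Finset.prod (Finset.range k) (fun i => if i ∈ (cl ω j) then (1 : ℝ) - q i else 1))) else 0)) with hEe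
    set P0 : ℝ := ∑ ω ∈ s, p ω * (if k ∈ L ω then (0 : ℝ) else (Finset.prod (Finset.range k) (fun i => if i ∈ (L ω) then (1 : ℝ) - q i else 1))) with hP0
    set Pc : ℝ := ∑ ω ∈ s, p ω * (if k ∈ L ω then (0 : ℝ) else (Finset.prod (Finset.range k) (fun i => if i ∈ (cl ω k) then (1 : ℝ) - q i else 1))) with hPc
    set PcL : ℝ := ∑ ω ∈ s, p ω * (if k ∈ L ω then (0 : ℝ) else (Finset.prod (Finset.range k) (fun i => if i ∈ (cl ω k) then (1 : ℝ) - q i else 1)) * (Finset.prod (Finset.range k) (fun i => if i ∈ (L ω) then (1 : ℝ) - q i else 1))) with hPcL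
    set SW : Ω → ℝ := fun ω => ∑ j ∈ (Finset.range k).filter (fun j => j ∈ cl ω k), ((q j) * Finset.prod (Finset.Ico (j + 1) k) (fun i => (1 : ℝ) - q i)) with hSW
    have hCE_split : ∀ j, CE j = Cc j + Ee j := by
      intro j
      simp only [hCE, hCc, hEe]
      rw [← Finset.sum_add_distrib]
      refine Finset.sum_congr rfl fun ω _ => ?_
      split_ifs <;> ring
    -- the right-hand side of the goal, rewritten
    have hRHS : ∑ j ∈ Finset.range (k + 1), ((q j) * Finset.prod (Finset.Ico (j + 1) (k + 1)) (fun i => (1 : ℝ) - q i)) * (Finset.sum s (fun ω => p ω * (if j ∈ L ω then (0 : ℝ) else ((Finset.prod (Finset.range ((k + 1))) (fun i => if i ∈ (cl ω j) then (1 : ℝ) - q i else 1)) + (Finset.prod (Finset.range ((k + 1))) (fun i => if i ∈ (L ω) then (1 : ℝ) - q i else 1)) - (Finset.prod (Finset.range ((k + 1))) (fun i => if i ∈ (cl ω j) then (1 : ℝ) - q i else 1)) * (Finset.prod (Finset.range ((k + 1))) (fun i => if i ∈ (L ω) then (1 : ℝ) - q i else 1)))))) = (1 - q k) * ∑ j ∈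 Finset.range k, ((q j) * Finset.prod (Finset.Ico (j + 1) k) (fun i => (1 : ℝ) - q i)) * (Finset.sum s (fun ω => p ω * (if j ∈ L ω then (0 : ℝ) else ((Finset.prod (Finset.range k) (fun i => if i ∈ (cl ω j) then (1 : ℝ) - q i else 1)) + (Finset.prod (Finset.range k) (fun i => if i ∈ (L ω) then (1 : ℝ) - q i else 1)) - (Finset.prod (Finset.range k) (fun i => if i ∈ (cl ω j) then (1 : ℝ) - q i else 1)) * (Finset.prod (Finset.range k) (fun i => if i ∈ (L ω) then (1 : ℝ) - q i else 1)))))) - (1 - q k) * q k * ∑ j ∈ Finset.range k, ((q j) * Finset.prod (Finset.Ico (j + 1) k) (fun i => (1 : ℝ) - q i)) * CE j + q k * (Finset.sum s (fun ω => p ω * (if k ∈ L ω then (0 : ℝ) else ((Finset.prod (Finset.range ((k + 1))) (fun i => if i ∈ (cl ω k) then (1 : ℝ) - q i else 1)) + (Finset.prod (Finset.range ((k + 1))) (fun i => if i ∈ (L ω) then (1 : ℝ) - q i else 1)) - (Finset.prod (Finset.range ((k + 1))) (fun i => if i ∈ (cl ω k) then (1 : ℝ) - q i else 1)) * (Finset.prod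 (Finset.range ((k + 1))) (fun i => if i ∈ (L ω) then (1 : ℝ) - q i else 1)))))) := by
      rw [Finset.sum_range_succ, slW_succ_self, Finset.mul_sum (s := Finset.range k) (a := 1 - q k),
        Finset.mul_sum (s := Finset.range k) (a := (1 - q k) * q k), ← Finset.sum_sub_distrib]
      congr 1
      refine Finset.sum_congr rfl fun j hj => ?_
      have hjk : j < k := Finset.mem_range.1 hj
      rw [slW_succ_of_lt q hjk, sbRT_succ_of_lt s p L cl hdisj q k j]
      simp only [hCE]
      ring
    have hRk : (Finset.sum s (fun ω => p ω * (if k ∈ L ω then (0 : ℝ) else ((Finset.prod (Finset.range ((k + 1))) (fun i => if i ∈ (cl ω k) then (1 : ℝ) - q i else 1)) + (Finset.prod (Finset.range ((k + 1))) (fun i => if i ∈ (L ω) then (1 : ℝ) - q i else 1)) - (Finset.prod (Finset.range ((k + 1))) (fun i => if i ∈ (cl ω k) then (1 : ℝ) - q i else 1)) * (Finset.prod (Finset.range ((k + 1))) (fun i => if i ∈ (L ω) then (1 : ℝ) - q i else 1)))))) = (1 - q k) * Pc + P0 - (1 - q k) * PcL := by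
      rw [sbRT_succ_self s p L cl hself q k, hPc, hP0, hPcL, Finset.mul_sum, Finset.mul_sum,
        ← Finset.sum_add_distrib, ← Finset.sum_sub_distrib]
      refine Finset.sum_congr rfl fun ω _ => ?_
      split_ifs <;> ring
    -- KEY: Σ_j w_j CE_j ≤ Pc − PcL
    have hkey : ∑ j ∈ Finset.range k, ((q j) * Finset.prod (Finset.Ico (j + 1) k) (fun i => (1 : ℝ) - q i)) * CE j ≤ Pc - PcL := by
      have hC : ∑ j ∈ Finset.range k, ((q j) * Finset.prod (Finset.Ico (j + 1) k) (fun i => (1 : ℝ) - q i)) * Cc j = ∑ ω ∈ s, p ω * (if k ∈ L ω then (0 : ℝ) else (Finset.prod (Finset.range k) (fun i => if i ∈ (cl ω k) then (1 : ℝ) - q i else 1)) * (1 - (Finset.prod (Finset.range k) (fun i => if i ∈ (L ω) then (1 : ℝ) - q i else 1))) * SW ω) := by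
        simp only [hCc, hSW]
        exact sbC_regroup s p L cl hself hdisj hblk q k
      have hE : ∑ j ∈ Finset.range k, ((q j) * Finset.prod (Finset.Ico (j + 1) k) (fun i => (1 : ℝ) - q i)) * Ee j ≤ ∑ ω ∈ s, p ω * (if k ∈ L ω then (0 : ℝ) else (Finset.prod (Finset.range k) (fun i => if i ∈ (cl ω k) then (1 : ℝ) - q i else 1)) * (1 - (Finset.prod (Finset.range k) (fun i => if i ∈ (L ω) then (1 : ℝ) - q i else 1))) * (1 - SW ω)) := by
        simp only [hEe, hSW]
        exact sbBracket_le s p hp L cl hdisj q hq0 hq1 k (hBX k (Nat.lt_succ_self k))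
      have hsum : ∑ j ∈ Finset.range k, ((q j) * Finset.prod (Finset.Ico (j + 1) k) (fun i => (1 : ℝ) - q i)) * CE j = ∑ j ∈ Finset.range k, ((q j) * Finset.prod (Finset.Ico (j + 1) k) (fun i => (1 : ℝ) - q i)) * Cc j + ∑ j ∈ Finset.range k, ((q j) * Finset.prod (Finset.Ico (j + 1) k) (fun i => (1 : ℝ) - q i)) * Ee j := by
        rw [← Finset.sum_add_distrib]
        refine Finset.sum_congr rfl fun j _ => ?_
        rw [hCE_split]; ring
      have htot : ∑ ω ∈ s, p ω * (if k ∈ L ω then (0 : ℝ) else (Finset.prod (Finset.range k) (fun i => if i ∈ (cl ω k) then (1 : ℝ) - q i else 1)) * (1 - (Finset.prod (Finset.range k) (fun i => if i ∈ (L ω) then (1 : ℝ) - q i else 1))) * SW ω) + ∑ ω ∈ s, p ω * (if k ∈ L ω then (0 : ℝ) else (Finset.prod (Finset.range k) (fun i => if i ∈ (cl ω k) then (1 : ℝ) - q i else 1)) * (1 - (Finset.prod (Finset.range k) (fun i => if i ∈ (L ω) then (1 : ℝ) - q i else 1))) * (1 - SW ω)) = Pc - PcL := by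
        rw [hPc, hPcL, ← Finset.sum_add_distrib, ← Finset.sum_sub_distrib]
        refine Finset.sum_congr rfl fun ω _ => ?_
        split_ifs <;> ring
      rw [hsum, hC]
      linarith [hE, htot]
    -- assemble
    rw [slBad_succ, hRHS, hRk]
    have hIH' : (1 - q k) * (Finset.sum s (fun ω => p ω * ((Finset.prod (Finset.range k) (fun i => if i ∈ (L ω) then (1 : ℝ) - q i else 1)) - Finset.prod (Finset.range k) (fun i => (1 : ℝ) - q i)))) ≤ (1 - q k) * ∑ j ∈ Finset.range k, ((q j) * Finset.prod (Finset.Ico (j + 1) k) (fun i => (1 : ℝ) - q i)) * (Finset.sum s (fun ω => p ω * (if j ∈ L ω then (0 : ℝ) else ((Finset.prod (Finset.range k) (fun i => if i ∈ (cl ω j) then (1 : ℝ) - q i else 1)) + (Finset.prod (Finset.range k) (fun i => if i ∈ (L ω) then (1 : ℝ) - q i else 1)) - (Finset.prod (Finset.range k) (fun i => if i ∈ (cl ω j) then (1 : ℝ) - q i else 1)) * (Finset.prod (Finset.range k) (fun i => if i ∈ (L ω) then (1 : ℝ) - q i else 1)))))) :=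
      mul_le_mul_of_nonneg_left IH hqk1
    rw [← hP0]
    nlinarith [mul_le_mul_of_nonneg_left (mul_le_mul_of_nonneg_left hkey hqk0) hqk1, hIH']

/-- **The Block Star Lemma, registered form** (stub `starLemmaBlocks` of stmt-CriticalPhenomena-4575): the statement of
`starLemmaBlocks'` with all binders after the colon. -/
theorem starLemmaBlocks : ∀ {Ω : Type*} (s : Finset Ω) (p : Ω → ℝ), (∀ ω ∈ s, 0 ≤ p ω) → ∀ (L : Ω → Finset ℕ) (cl : Ω → ℕ → Finset ℕ), (∀ ω ∈ s, ∀ j, j ∈ cl ω j) → (∀ ω ∈ s, ∀ j, j ∉ L ω → Disjoint (cl ω j) (L ω)) → (∀ ω ∈ s, ∀ i j, j ∉ L ω → i ∈ cl ω j → cl ω i = cl ω j) → ∀ (q : ℕ → ℝ), (∀ j, 0 ≤ q j) → (∀ j, q j ≤ 1) → ∀ (k : ℕ), (∀ m, m < k → ∀ (Z : Finset ℕ), Z ⊆ Finset.range m → ∀ h, h < m → (∑ ω ∈ s, p ω * (if m ∈ L ω ∧ h ∉ L ω ∧ Disjoint Z (L ω) ∧ ¬ Disjoint Z (cl ω h)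 then (1 : ℝ) else 0)) ≤ ∑ ω ∈ s, p ω * (if m ∉ L ω ∧ Disjoint Z (cl ω m) ∧ ¬ Disjoint Z (L ω) ∧ h ∉ cl ω m then (1 : ℝ) else 0)) → (Finset.sum s (fun ω => p ω * ((Finset.prod (Finset.range k) (fun i => if i ∈ (L ω) then (1 : ℝ) - q i else 1)) - Finset.prod (Finset.range k) (fun i => (1 : ℝ) - q i)))) ≤ ∑ j ∈ Finset.range k, ((q j) * Finset.prod (Finset.Ico (j + 1) k) (fun i => (1 : ℝ) - q i)) * (Finset.sum s (fun ω => p ω * (if j ∈ L ω then (0 : ℝ) else ((Finset.prod (Finset.range k) (fun i => if i ∈ (cl ω j) then (1 : ℝ) - q i else 1)) + (Finset.prod (Finset.range k) (fun i => if i ∈ (L ω) then (1 : ℝ) - q i else 1)) - (Finset.prod (Finset.range k) (fun i => if i ∈ (cl ω j) then (1 : ℝ) - q i else 1)) * (Finset.prod (Finset.range k) (fun i => if i ∈ (L ω) then (1 : ℝ) - q i else 1)))))) :=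
  fun s p hp L cl hself hdisj hblk q hq0 hq1 k hBX => starLemmaBlocks' s p hp L cl hself hdisj hblk q hq0 hq1 k hBX

end Summit.CriticalPhenomena.PercolationContinuityZ3.Theorems
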